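import Mathlib
import Literature.AlgebraicGeometry.Resolution.CobordantGame
import Literature.AlgebraicGeometry.Resolution.CobordantChartOneMove
import Summits.ResolutionOfSingularities.ResolutionOfSingularities.Theorems.WeightedInvariantLocalWeightedDropOffVertexConeWin

/-!
# `WeightedInvariant.LocalWeightedDrop`: the REFUTE-L1 specimen FD-1 — MOVE ONE (§4 R2-1, first half)

Route `ResolutionOfSingularities/WeightedInvariant`, crux `LocalWeightedDrop`
(stmt-ResolutionOfSingularities-8899).  [OURS · L1 W4.3] — first half of §4 R2-1 `won_FD1` of ideator res-L1-w43-idea-1's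
`Sketch-L1-idea-1.lean` (v4): card A's first move on the tri-2 TESTBANK specimen FD-1 at a point of its twisted line,
`f = z⁴ + (x₀+ξ)²y⁴ + s y⁵`, `x₀ ≠ 0` (`0 = ξ, 1 = y, 2 = z, 3 = s`; char 2): centre `V(z, y)` = the plane `P ⊋ ℓ`, weights
`w₁ = (0, 1, 1, 0)`.  Nothing here is a statement of the manuscript under review on ladder RESOLUTION; AI-produced, weaker than
expert review.

`f` is NOT weighted-homogeneous: `f = P₄ + P₅` with `P₄ = z⁴ + (x₀+ξ)²y⁴` of weight `4` and `P₅ = s y⁵` of weight `5`.  The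
tree's singular-successor criterion (`CobordantChart.successor_singular_iff`) at an exceptional point `c = (0, c₁, c₂, 0)`
reads `P₄(c) = 0 ∧ ∇P₄(c) = 0 ∧ P₅(c) = 0`; in characteristic `2` the gradient of `P₄` vanishes identically and `P₅(c) = 0`
automatically, so the singular successors are EXACTLY the points with `c₂⁴ + x₀²c₁⁴ = (c₂² + x₀c₁²)² = 0`, i.e. the torus orbit
`c₂² = x₀ c₁²`, `c₁ ≠ 0` (the line `ℓ`), with successor
`G = (c₂ + z)⁴ + (x₀ + ξ)²(c₁ + y)⁴ + t·s·(c₁ + y)⁵ ∈ k⟦t, ξ, y, z, s⟧` (`fd1_isSuccessor_classification`).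
The second move is the companion module `…FD1Won`.
-/

set_option linter.dupNamespace false -- mandated namespace of this single-conjunct summit
set_option autoImplicit false

namespace Summit.ResolutionOfSingularities.ResolutionOfSingularities.Theorems

namespace GradedGame

open MvPowerSeries
open Literature.AlgebraicGeometry.Resolution
open Literature.AlgebraicGeometry.Resolution.CobordantChart

variable {k : Type} [Field k]

/-- The chart transform of FD-1 at a point `c = (0, c₁, c₂, 0)` of the move `(X, (0,1,1,0))`:
`f(ξ, t(c₁+y), t(c₂+z), s) = t⁴ · G`. [OURS · L1 W4.3] -/
theorem fd1_chart (x₀ c₁ c₂ : k) :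
    subst (chart ![0, 1, 1, 0] ![(0 : k), c₁, c₂, 0])
        (X 2 ^ 4 + (C x₀ + X 0) ^ 2 * X 1 ^ 4 + X 3 * X 1 ^ 5 : MvPowerSeries (Fin 4) k)
      = X (0 : Fin (4 + 1)) ^ 4 *
        ((C c₂ + X 3) ^ 4 + (C x₀ + X 1) ^ 2 * (C c₁ + X 2) ^ 4 + X 0 * X 4 * (C c₁ + X 2) ^ 5) := by
  have hc : ∀ i, (![0, 1, 1, 0] : Fin 4 → ℕ) i = 0 → (![(0 : k), c₁, c₂, 0] : Fin 4 → k) i = 0 := by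
    intro i hi; fin_cases i <;> simp_all
  have hch := hasSubst_chart (![0, 1, 1, 0]) (![(0 : k), c₁, c₂, 0]) hc
  have h0 : chart ![0, 1, 1, 0] ![(0 : k), c₁, c₂, 0] 0 = X 1 := by rw [chart_apply]; simp
  have h1 : chart ![0, 1, 1, 0] ![(0 : k), c₁, c₂, 0] 1 = X 0 * (C c₁ + X 2) := by rw [chart_apply]; simp
  have h2 : chart ![0, 1, 1, 0] ![(0 : k), c₁, c₂, 0] 2 = X 0 * (C c₂ + X 3) := by rw [chart_apply]; simp
  have h3 : chart ![0, 1, 1, 0] ![(0 : k), c₁, c₂, 0] 3 = X 4 := by rw [chart_apply]; simp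
  simp only [subst_add hch, subst_mul hch, subst_pow hch, subst_X hch, subst_C]
  rw [h0, h1, h2, h3]
  ring

/-- MOVE ONE OF CARD A ON FD-1 (char 2, every field, `x₀` arbitrary): every singular `s`-saturated successor of the move
`(X, (0,1,1,0))` (centre `V(y, z)`) is `G = (c₂ + z)⁴ + (x₀ + ξ)²(c₁ + y)⁴ + t·s·(c₁ + y)⁵` at a point of the line
`c₂² = x₀c₁²`, `c₁ ≠ 0`. [OURS · L1 W4.3, Sketch-L1-idea-1 v4 §4 R2-1, first move] -/
theorem fd1_isSuccessor_classification [CharP k 2] (x₀ : k) (g : MvPowerSeries (Fin 5) k)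
    (hg : CobordantGame.IsSuccessor k (X 2 ^ 4 + (C x₀ + X 0) ^ 2 * X 1 ^ 4 + X 3 * X 1 ^ 5 : MvPowerSeries (Fin 4) k)
      MvPowerSeries.X ![0, 1, 1, 0] g) :
    ∃ c₁ c₂ : k, c₁ ≠ 0 ∧ c₂ ^ 2 = x₀ * c₁ ^ 2 ∧
      g = (C c₂ + X 3) ^ 4 + (C x₀ + X 1) ^ 2 * (C c₁ + X 2) ^ 4 + X 0 * X 4 * (C c₁ + X 2) ^ 5 := by
  classical
  obtain ⟨c, a, hoff, hfac, hndvd, hsing⟩ := hg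
  set w : Fin 4 → ℕ := ![0, 1, 1, 0] with hw
  -- the two weighted pieces of `f`
  set P4 : MvPolynomial (Fin 4) k := MvPolynomial.X 2 ^ 4 + (MvPolynomial.C x₀ + MvPolynomial.X 0) ^ 2 * MvPolynomial.X 1 ^ 4
    with hP4def
  set P5 : MvPolynomial (Fin 4) k := MvPolynomial.X 3 * MvPolynomial.X 1 ^ 5 with hP5def
  set P : MvPolynomial (Fin 4) k := P4 + P5 with hPdef
  have hcoe : (P : MvPowerSeries (Fin 4) k) = X 2 ^ 4 + (C x₀ + X 0) ^ 2 * X 1 ^ 4 + X 3 * X 1 ^ 5 := by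
    simp [hPdef, hP4def, hP5def, MvPolynomial.coe_add, MvPolynomial.coe_mul, MvPolynomial.coe_pow, MvPolynomial.coe_X,
      MvPolynomial.coe_C]
  -- the truncated point `c'`
  set c' : Fin 4 → k := fun i => if 0 < w i then c i else 0 with hc'
  have hc'0 : ∀ i, w i = 0 → c' i = 0 := fun i hi => by simp [hc', hi]
  have hfac' : subst (chart w c') (P : MvPowerSeries (Fin 4) k) = X 0 ^ a * g := by
    rw [hcoe, ← cruxChart_eq_chart]
    have : subst (MvPowerSeries.X : Fin 4 → MvPowerSeries (Fin 4) k)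
        (X 2 ^ 4 + (C x₀ + X 0) ^ 2 * X 1 ^ 4 + X 3 * X 1 ^ 5 : MvPowerSeries (Fin 4) k) =
        X 2 ^ 4 + (C x₀ + X 0) ^ 2 * X 1 ^ 4 + X 3 * X 1 ^ 5 := by rw [MvPowerSeries.subst_self]; rfl
    rw [← this]
    exact hfac
  -- homogeneity of the pieces
  have hw0 : w 0 = 0 := rfl
  have hw1 : w 1 = 1 := rfl
  have hw2 : w 2 = 1 := rfl
  have hw3 : w 3 = 0 := rfl
  have hX0 := MvPolynomial.isWeightedHomogeneous_X (R := k) w 0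
  have hX1 := MvPolynomial.isWeightedHomogeneous_X (R := k) w 1
  have hX2 := MvPolynomial.isWeightedHomogeneous_X (R := k) w 2
  have hX3 := MvPolynomial.isWeightedHomogeneous_X (R := k) w 3
  rw [hw0] at hX0; rw [hw1] at hX1; rw [hw2] at hX2; rw [hw3] at hX3
  have hP4 : P4.IsWeightedHomogeneous w 4 := by
    have hA : (MvPolynomial.X 2 ^ 4 : MvPolynomial (Fin 4) k).IsWeightedHomogeneous w (4 • 1) := hX2.pow 4
    have hL : (MvPolynomial.C x₀ + MvPolynomial.X 0 : MvPolynomial (Fin 4) k).IsWeightedHomogeneous w 0 :=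
      (MvPolynomial.isWeightedHomogeneous_C w x₀).add hX0
    have hB : ((MvPolynomial.C x₀ + MvPolynomial.X 0) ^ 2 * MvPolynomial.X 1 ^ 4 : MvPolynomial (Fin 4) k).IsWeightedHomogeneous
        w (2 • 0 + 4 • 1) := (hL.pow 2).mul (hX1.pow 4)
    have e1 : (4 • 1 : ℕ) = 4 := rfl
    have e2 : (2 • 0 + 4 • 1 : ℕ) = 4 := rfl
    rw [e1] at hA; rw [e2] at hB
    rw [hP4def]; exact hA.add hB
  have hP5 : P5.IsWeightedHomogeneous w 5 := by
    have hB : (MvPolynomial.X 3 * MvPolynomial.X 1 ^ 5 : MvPolynomial (Fin 4) k).IsWeightedHomogeneous w (0 + 5 • 1) :=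
      hX3.mul (hX1.pow 5)
    have e2 : (0 + 5 • 1 : ℕ) = 5 := rfl
    rw [e2] at hB
    rw [hP5def]; exact hB
  -- the weighted order of `f` is `4`
  have hcoeff4 : coeff (Finsupp.single (2 : Fin 4) 4) (P : MvPowerSeries (Fin 4) k) = 1 := by
    rw [hcoe, map_add, map_add, coeff_X_pow, if_pos rfl,
      X_dvd_iff.mp ((dvd_pow_self (X 1 : MvPowerSeries (Fin 4) k) (by norm_num)).mul_left _) _ (by simp),
      X_dvd_iff.mp ((dvd_pow_self (X 1 : MvPowerSeries (Fin 4) k) (by norm_num)).mul_left _) _ (by simp),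
      add_zero, add_zero]
  have hP0' : (P : MvPowerSeries (Fin 4) k) ≠ 0 := by
    intro h; rw [h, map_zero] at hcoeff4; exact zero_ne_one hcoeff4
  have hord : (P : MvPowerSeries (Fin 4) k).weightedOrder w = (4 : ℕ) := by
    rw [weightedOrder_eq_nat]
    refine ⟨⟨Finsupp.single 2 4, by rw [hcoeff4]; exact one_ne_zero, by simp [Finsupp.weight_single, hw2]⟩,
      fun d hd => ?_⟩
    rw [MvPolynomial.coeff_coe, hPdef, MvPolynomial.coeff_add, hP4.coeff_eq_zero d (by omega),
      hP5.coeff_eq_zero d (by omega), add_zero]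
  have ha : a = 4 := by
    have h1 := eq_weightedOrder_of_factor w c' hc'0 hP0' hfac' hndvd
    rw [hord] at h1
    exact_mod_cast h1
  subst ha
  -- the cone equation at `c'`: in characteristic 2 only `P₄(c') = 0` carries information
  obtain ⟨hPa, -, -⟩ := (successor_singular_iff w c' hc'0 _ hfac').mp hsing
  rw [initEval_coe, hPdef, map_add, hP4.weightedHomogeneousComponent_same,
    hP5.weightedHomogeneousComponent_ne 4 (by norm_num), add_zero] at hPa
  have hc0 : c' 0 = 0 := hc'0 0 hw0
  have h2 : (2 : k) = 0 := CharP.ofNat_eq_zero k 2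
  have hrel : c' 2 ^ 2 = x₀ * c' 1 ^ 2 := by
    rw [hP4def] at hPa
    simp only [map_add, map_mul, map_pow, MvPolynomial.eval_X, MvPolynomial.eval_C, hc0, add_zero] at hPa
    -- `c₂⁴ + x₀² c₁⁴ = (c₂² + x₀ c₁²)² = 0`
    have hsq : (c' 2 ^ 2 + x₀ * c' 1 ^ 2) ^ 2 = 0 := by
      rw [← hPa]; linear_combination (c' 2 ^ 2 * x₀ * c' 1 ^ 2) * h2
    have h0 := pow_eq_zero_iff (n := 2) (by norm_num) |>.mp hsq
    linear_combination h0 - (x₀ * c' 1 ^ 2) * h2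
  have hc1 : c' 1 ≠ 0 := by
    intro h1
    have h2' : c' 2 = 0 := by
      have := hrel; rw [h1] at this; simpa using this
    obtain ⟨i, hi, hci⟩ := hoff
    have hci' : c' i ≠ 0 := by simp only [hc']; rw [if_pos hi]; exact hci
    fin_cases i
    · simp [hw] at hi
    · exact hci' h1
    · exact hci' h2'
    · simp [hw] at hi
  refine ⟨c' 1, c' 2, hc1, hrel, ?_⟩
  have hcvec : c' = ![(0 : k), c' 1, c' 2, 0] := by
    funext i
    fin_cases i
    · simpa using hc0
    · simp
    · simp
    · simpa using hc'0 3 hw3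
  rw [hcvec, hcoe, fd1_chart] at hfac'
  exact (mul_left_cancel₀ (pow_ne_zero 4 (nonZeroDivisors.ne_zero
    (X_mem_nonzeroDivisors (i := (0 : Fin (4 + 1))) (R := k)))) hfac').symm

end GradedGame

end Summit.ResolutionOfSingularities.ResolutionOfSingularities.Theorems
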